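import Literature.InformationTheory.QuantumCodes.CSSMixedChannelThreshold
import Literature.InformationTheory.QuantumCodes.CSSErasureCapacityConverse
import HarnessLib

/-!
# Loss–error tradeoff CEILING: `P_{y + 2p(1-y)}[erasure uncorrectable] ≤ 2 · P^mixed_{y,p}[D]` for EVERY
# decoder of the mixed (loss + flip) channel

Stace–Barrett–Doherty [StaceBarrettDoherty2009] computed the correctable region of the toric code in the
`(p_loss, p_err)` plane numerically; Dumer–Kovalev–Pryadko [DumerKovalevPryadko2015] Thm. 2 proved a certified
FLOOR curve for every CSS LDPC family (the tree's `CSSMixedChannelThreshold.lean`, `mixedFailureProb`: independent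
erasures of rate `y`, known to the decoder, and independent flips of rate `p`; failure robust in the errors on the
erased qubits). This file PROVES the matching CEILING mechanism, valid for EVERY erasure-aware decoder `D`:
flips of rate `p` on the kept qubits are erasures of rate `2p` filled with fair coins (Richardson–Urbanke's erasure
decomposition, Lemma 4.78), so the union of the loss pattern and the coin-erasure pattern is an independent erasure
pattern of rate `y + 2p(1 − y)`, and whenever that union supports a logical operator the coins defeat `D` at least
half the time (involution `E ↦ E Δ (supp ℓ ∩ Er₂)`; `two_pow_le_two_mul_card_mixed_fail`):

* `uncorrectableProb_le_two_mul_mixedFailureProb`: `P_{y+2p(1−y)}[erasure uncorrectable] ≤ 2 P^mixed_{y,p}[D]`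
  (`0 ≤ y ≤ 1`, `0 ≤ p ≤ 1/2`), every decoder — the case `y = 0` is `uncorrectableProb_two_mul_le`.
* union law of independent patterns (`sum_bernoulliWeight_mul_sum_union`): `E ∼ Ber(y)`, `F ∼ Ber(z)` independent
  ⇒ `E ∪ F ∼ Ber(y + (1−y)z)`; disjoint-coupling form `sum_pairWeight_union`.
* CSS codes with `k ≥ 1` whose two sectors have the same erasure behaviour (toric, planar, abelian two-block):
  `1/4 ≤ P^mixed_{y,p}[D]` on the curve `y + 2p(1−y) = 1/2`, i.e. `p = (1 − 2y)/(4(1 − y))`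
  (`CSSCode.quarter_le_mixedFailureProb_of_symm`); general `k ≥ 1`: `1/2 ≤ P^{mixed,Z}_{y,p} + P^{X}_{…}` forms via
  `CSSCode.one_le_uncorrectableProb_add`.
* Families: at loss rate `0 ≤ y < 1/2`, every certified flip-threshold lower bound `a` of the mixed family of an
  erasure-symmetric family with `k ≥ 1` satisfies `a ≤ (1 − 2y)/(4(1 − y))` (`mixed_threshold_le_of_symm`) — the
  certified ceiling curve of the loss–error phase diagram, for EVERY decoder family (only the curve point
  `y + 2p(1−y) = 1/2` is used; no monotonicity in `(y, p)` is claimed).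

## References

* [StaceBarrettDoherty2009] PRL 102 (2009) 200501, p. 2 and Fig. 2 (correctable region in the (p_loss, p_com) plane).
* [DumerKovalevPryadko2015] PRL 115 (2015) 050502, Thm. 2 and eq. (min-E-condition) (mixed channel).
* [RichardsonUrbanke2008] Modern Coding Theory, Lemma 4.78 (Erasure Decomposition Lemma).
* [DelfosseZemor2020] §2 (random Pauli error inside the erasure; all cosets equiprobable).

## Mathlib / tree search

Tree: `mixedFailureProb`, `bernoulliWeight_eq_sum_superset`, `card_filter_supp_subset`, `supp`, `vecOf`,
`supp_vecOf`, `vecOf_supp`, `sum_bernoulliWeight_filter_inter`, `ErasureDecoder.uncorrectableProb_eq_sum`,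
`CSSCode.one_le_uncorrectableProb_add`, `not_belowThreshold_of_le`, `sum_pairWeight_mul_left` (shape).
Mathlib: `Finset.sum_fiberwise_of_maps_to`, `Finset.sum_comm'`, `Finset.sum_nbij'`, `Finset.sum_pow_mul_eq_add_pow`,
`Finset.card_le_card_of_injOn`.
-/

namespace Literature.InformationTheory.QuantumCodes

open Finset Matrix Filter Topology

/-! ### The law of the union of two independent erasure patterns -/

section UnionLaw

variable {V : Type*} [Fintype V] [DecidableEq V]

/-- **The union under the disjoint coupling is `Ber(a + b)`**: weighting disjoint pairs `(E, F)`, `F ⊆ Eᶜ`, by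
`a^{|E|} b^{|F|} (1−a−b)^{n−|E|−|F|}`, the law of `E ∪ F` is the independent law of rate `a + b` (re-index by
`C = E ∪ F ⊇ E` and use the binomial theorem on `C`). [cite: RichardsonUrbanke2008, Lemma 4.78 (composition of erasure channels)] -/
theorem sum_pairWeight_union (a b : ℝ) (h : Finset V → ℝ) :
    ∑ E : Finset V, ∑ F ∈ (Eᶜ).powerset,
        a ^ E.card * (b ^ F.card * (1 - a - b) ^ (Eᶜ.card - F.card)) * h (E ∪ F) =
      ∑ C : Finset V, bernoulliWeight (a + b) C * h C := by
  -- inner re-indexing `F ↦ E ∪ F`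
  have hinner : ∀ E : Finset V, ∑ F ∈ (Eᶜ).powerset,
      a ^ E.card * (b ^ F.card * (1 - a - b) ^ (Eᶜ.card - F.card)) * h (E ∪ F) =
        ∑ C ∈ univ.filter (fun C : Finset V => E ⊆ C),
          a ^ E.card * (b ^ (C.card - E.card) * (1 - a - b) ^ (Fintype.card V - C.card)) * h C := by
    intro E
    refine Finset.sum_nbij' (fun F => E ∪ F) (fun C => C \ E) ?_ ?_ ?_ ?_ ?_
    · intro F _
      rw [Finset.mem_filter]
      exact ⟨mem_univ _, Finset.subset_union_left⟩
    · intro C _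
      rw [Finset.mem_powerset]
      intro x hx
      rw [Finset.mem_sdiff] at hx
      exact Finset.mem_compl.2 hx.2
    · intro F hF
      rw [Finset.mem_powerset] at hF
      rw [Finset.union_sdiff_left]
      exact Finset.sdiff_eq_self_of_disjoint (Finset.disjoint_left.2 fun x hxF hxE =>
        (Finset.mem_compl.1 (hF hxF)) hxE)
    · intro C hC
      rw [Finset.mem_filter] at hC
      exact Finset.union_sdiff_of_subset hC.2
    · intro F hF
      rw [Finset.mem_powerset] at hF
      have hdisj : Disjoint E F :=
        Finset.disjoint_left.2 fun x hxE hxF => (Finset.mem_compl.1 (hF hxF)) hxE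
      rw [Finset.card_union_of_disjoint hdisj, Finset.card_compl, Nat.add_sub_cancel_left]
      have : Fintype.card V - E.card - F.card = Fintype.card V - (E.card + F.card) := by omega
      rw [this]
  rw [Finset.sum_congr rfl fun E _ => hinner E,
    Finset.sum_comm' (t' := (univ : Finset (Finset V))) (s' := fun C => C.powerset)
      (fun E C => by simp [Finset.mem_filter, Finset.mem_powerset])]
  refine Finset.sum_congr rfl fun C _ => ?_
  have hterm : ∀ E ∈ C.powerset,
      a ^ E.card * (b ^ (C.card - E.card) * (1 - a - b) ^ (Fintype.card V - C.card)) * h C =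
        a ^ E.card * b ^ (C.card - E.card) * ((1 - a - b) ^ (Fintype.card V - C.card) * h C) := by
    intro E _
    ring
  rw [Finset.sum_congr rfl hterm, ← Finset.sum_mul, Finset.sum_pow_mul_eq_add_pow, bernoulliWeight,
    show 1 - (a + b) = 1 - a - b by ring]
  ring

/-- **Marginalising the part of an independent pattern inside a fixed set**: for a function of `A ∪ B` with `A`
fixed, `Σ_B z^{|B|}(1−z)^{n−|B|} f(A ∪ B) = Σ_{F ⊆ Aᶜ} z^{|F|}(1−z)^{|Aᶜ|−|F|} f(A ∪ F)`.
[cite: DennisEtAl2002, §4.1 (independent errors on different qubits)] -/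
theorem sum_bernoulliWeight_union_left (z : ℝ) (A : Finset V) (f : Finset V → ℝ) :
    ∑ B : Finset V, bernoulliWeight z B * f (A ∪ B) =
      ∑ F ∈ (Aᶜ).powerset, z ^ F.card * (1 - z) ^ ((Aᶜ).card - F.card) * f (A ∪ F) := by
  classical
  -- group the patterns `B` by their trace `F = Aᶜ ∩ B`
  rw [← Finset.sum_fiberwise_of_maps_to (s := (univ : Finset (Finset V))) (t := (Aᶜ).powerset)
    (g := fun B : Finset V => Aᶜ ∩ B) (fun B _ => Finset.mem_powerset.2 Finset.inter_subset_left)]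
  refine Finset.sum_congr rfl fun F hF => ?_
  have hFA : F ⊆ Aᶜ := Finset.mem_powerset.1 hF
  have hcongr : ∀ B ∈ univ.filter (fun B : Finset V => Aᶜ ∩ B = F),
      bernoulliWeight z B * f (A ∪ B) = bernoulliWeight z B * f (A ∪ F) := by
    intro B hB
    rw [mem_filter] at hB
    have : A ∪ B = A ∪ F := by
      rw [← hB.2]
      ext v
      simp only [Finset.mem_union, Finset.mem_inter, Finset.mem_compl]
      tauto
    rw [this]
  rw [Finset.sum_congr rfl hcongr, ← Finset.sum_mul]
  congr 1
  have h := sum_bernoulliWeight_filter_inter z Aᶜ (fun X => X = F)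
  rw [Finset.filter_eq' , if_pos hF] at h
  simpa using h

/-- **Union law**: if `A ∼ Ber(y)` and `B ∼ Ber(z)` are independent erasure patterns then `A ∪ B ∼ Ber(y + (1−y)z)`:
`Σ_A Σ_B y^{|A|}(1−y)^{n−|A|} z^{|B|}(1−z)^{n−|B|} f(A ∪ B) = Σ_C w^{|C|}(1−w)^{n−|C|} f(C)`, `w = y + (1−y)z`.
[cite: RichardsonUrbanke2008, Lemma 4.78 (composition of erasure channels); DumerKovalevPryadko2015, App. A (effective erasure probability)] -/
theorem sum_bernoulliWeight_mul_sum_union (y z : ℝ) (f : Finset V → ℝ) :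
    ∑ A : Finset V, bernoulliWeight y A * ∑ B : Finset V, bernoulliWeight z B * f (A ∪ B) =
      ∑ C : Finset V, bernoulliWeight (y + (1 - y) * z) C * f C := by
  have hstep : ∀ A : Finset V, bernoulliWeight y A * ∑ B : Finset V, bernoulliWeight z B * f (A ∪ B) =
      ∑ F ∈ (Aᶜ).powerset, y ^ A.card * (((1 - y) * z) ^ F.card *
        (1 - y - (1 - y) * z) ^ ((Aᶜ).card - F.card)) * f (A ∪ F) := by
    intro A
    rw [sum_bernoulliWeight_union_left, Finset.mul_sum]
    refine Finset.sum_congr rfl fun F hF => ?_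
    have hFc : F.card ≤ (Aᶜ).card := Finset.card_le_card (Finset.mem_powerset.1 hF)
    rw [bernoulliWeight, Finset.card_compl]
    rw [Finset.card_compl] at hFc
    have hsplit : (1 - y) ^ (Fintype.card V - A.card) =
        (1 - y) ^ F.card * (1 - y) ^ (Fintype.card V - A.card - F.card) := by
      rw [← pow_add]
      congr 1
      omega
    rw [hsplit, show 1 - y - (1 - y) * z = (1 - y) * (1 - z) by ring, mul_pow, mul_pow]
    ring
  rw [Finset.sum_congr rfl fun A _ => hstep A, sum_pairWeight_union y ((1 - y) * z) f]

end UnionLaw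

/-! ### On an uncorrectable union every erasure-aware decoder loses at least half the coin tosses -/

section Counting

variable {R V : Type*} [Fintype V] [DecidableEq V]

omit [Fintype V] in
/-- The support of a sum lies in the union of the supports. [folklore] -/
private theorem supp_add_subset'' [Fintype V] (a b : V → ZMod 2) : supp (a + b) ⊆ supp a ∪ supp b := by
  intro v hv
  rw [mem_union]
  simp only [supp, mem_filter, mem_univ, true_and, Pi.add_apply] at hv ⊢
  by_contra h
  push Not at h
  rw [h.1, h.2, add_zero] at hv
  exact hv rfl

/-- **The involution.** If a non-trivial logical operator `ℓ` of this type is supported inside `Er ∪ Er₂`, then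
for ANY erasure-aware decoder `D` given the loss pattern `Er`, among the `2^{|Er₂|}` flip patterns `E ⊆ Er₂` at least
half are failures in the robust sense (some error agreeing with `E` off `Er` defeats `D`): `E ↦ E Δ (supp ℓ ∩ Er₂)`
maps successes to failures. [cite: DelfosseZemor2020, §2 (P̃ and P differ in a logical operator L ⊂ ℰ); RichardsonUrbanke2008, Lemma 4.78] -/
theorem two_pow_le_two_mul_card_mixed_fail [Fintype R] (H : Matrix R V (ZMod 2))
    (S : Submodule (ZMod 2) (V → ZMod 2)) (D : ErasureDecoder V (R → ZMod 2)) {Er Er₂ : Finset V}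
    (hunc : ¬ IsCorrectableErasure {x | H *ᵥ x = 0} (S : Set (V → ZMod 2)) (Er ∪ Er₂))
    [DecidablePred fun E : Finset V => ∃ e : V → ZMod 2, supp e \ Er = E \ Er ∧
      ¬ D.Corrects (fun e => H *ᵥ e) (S : Set (V → ZMod 2)) Er e] :
    2 ^ Er₂.card ≤ 2 * ((Er₂.powerset).filter fun E : Finset V => ∃ e : V → ZMod 2,
        supp e \ Er = E \ Er ∧ ¬ D.Corrects (fun e => H *ᵥ e) (S : Set (V → ZMod 2)) Er e).card := by
  classical
  unfold IsCorrectableErasure at hunc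
  push Not at hunc
  obtain ⟨ℓ, hℓN, hℓE, hℓS⟩ := hunc
  have hℓ0 : H *ᵥ ℓ = 0 := hℓN
  -- the coin part of `ℓ`
  set ℓ₂ : V → ZMod 2 := fun v => if v ∈ Er₂ then ℓ v else 0 with hℓ₂
  have hℓ₂supp : supp ℓ₂ ⊆ Er₂ := by
    intro v hv
    simp only [supp, mem_filter, mem_univ, true_and, hℓ₂] at hv
    by_contra h
    exact hv (if_neg h)
  -- off `Er`, adding `ℓ₂` is adding `ℓ`
  have hoff : ∀ (e : V → ZMod 2) (v : V), v ∉ Er → (e + ℓ₂) v = (e + ℓ) v := by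
    intro e v hv
    simp only [Pi.add_apply, hℓ₂]
    by_cases hv2 : v ∈ Er₂
    · rw [if_pos hv2]
    · rw [if_neg hv2]
      have : ℓ v = 0 := by
        by_contra hne
        have hvℓ : v ∈ supp ℓ := by simpa [supp] using hne
        rcases Finset.mem_union.1 (hℓE hvℓ) with h | h
        · exact hv h
        · exact hv2 h
      rw [this]
  -- vectors supported in `Er₂`, failures and successes among them
  set A := univ.filter fun e : V → ZMod 2 => supp e ⊆ Er₂ with hA
  set good := A.filter fun e => ¬ ∃ e' : V → ZMod 2, supp e' \ Er = supp e \ Er ∧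
      ¬ D.Corrects (fun e => H *ᵥ e) (S : Set (V → ZMod 2)) Er e' with hgood
  set bad := A.filter fun e => ∃ e' : V → ZMod 2, supp e' \ Er = supp e \ Er ∧
      ¬ D.Corrects (fun e => H *ᵥ e) (S : Set (V → ZMod 2)) Er e' with hbad
  have hsplit : bad.card + good.card = A.card := Finset.card_filter_add_card_filter_not _
  have hAcard : A.card = 2 ^ Er₂.card := card_filter_supp_subset Er₂
  -- the involution maps successes into failures
  have hmap : ∀ e ∈ good, e + ℓ₂ ∈ bad := by
    intro e he
    rw [hgood, mem_filter, hA, mem_filter] at he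
    rw [hbad, mem_filter, hA, mem_filter]
    refine ⟨⟨mem_univ _, (supp_add_subset'' e ℓ₂).trans (union_subset he.1.2 hℓ₂supp)⟩, ?_⟩
    -- `e` itself witnesses that `D` corrects `e`
    have hsucc : D.Corrects (fun e => H *ᵥ e) (S : Set (V → ZMod 2)) Er e := by
      by_contra hfail
      exact he.2 ⟨e, rfl, hfail⟩
    refine ⟨e + ℓ, ?_, ?_⟩
    · ext v
      simp only [Finset.mem_sdiff, supp, mem_filter, mem_univ, true_and]
      constructor
      · rintro ⟨hv, hvEr⟩
        exact ⟨by rw [hoff e v hvEr]; exact hv, hvEr⟩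
      · rintro ⟨hv, hvEr⟩
        exact ⟨by rw [← hoff e v hvEr]; exact hv, hvEr⟩
    · intro hbad'
      have hsyn : H *ᵥ (e + ℓ) = H *ᵥ e := by rw [Matrix.mulVec_add, hℓ0, add_zero]
      have h1 : D Er (H *ᵥ e) + e ∈ S := hsucc
      have h2 : D Er (H *ᵥ e) + (e + ℓ) ∈ S := by
        have h2' : D Er (H *ᵥ (e + ℓ)) + (e + ℓ) ∈ S := hbad'
        rwa [hsyn] at h2'
      apply hℓS
      have h3 := S.sub_mem h2 h1
      rwa [add_sub_add_left_eq_sub, add_sub_cancel_left] at h3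
  have hinj : Set.InjOn (fun e : V → ZMod 2 => e + ℓ₂) good := fun a _ b _ h => add_right_cancel h
  have hle : good.card ≤ bad.card := Finset.card_le_card_of_injOn (fun e => e + ℓ₂) hmap hinj
  -- failures among vectors ↔ failures among subsets of `Er₂`
  have hbadcard : bad.card = ((Er₂.powerset).filter fun E : Finset V => ∃ e : V → ZMod 2,
      supp e \ Er = E \ Er ∧ ¬ D.Corrects (fun e => H *ᵥ e) (S : Set (V → ZMod 2)) Er e).card := by
    refine Finset.card_nbij' supp vecOf ?_ ?_ (fun e _ => vecOf_supp e) (fun E _ => supp_vecOf E)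
    · intro e he
      rw [Finset.mem_coe, hbad, mem_filter, hA, mem_filter] at he
      rw [Finset.mem_coe, mem_filter, Finset.mem_powerset]
      exact ⟨he.1.2, he.2⟩
    · intro E hE
      rw [Finset.mem_coe, mem_filter, Finset.mem_powerset] at hE
      rw [Finset.mem_coe, hbad, mem_filter, hA, mem_filter, supp_vecOf]
      exact ⟨⟨mem_univ _, hE.1⟩, hE.2⟩
  rw [← hbadcard]
  omega

end Counting

/-! ### The ceiling: `P_{y+2p(1-y)}[uncorrectable] ≤ 2 P^mixed_{y,p}[D]` -/

section Mixed

variable {ι V : Type*} [Fintype ι] [Fintype V] [DecidableEq V]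

open Classical in
/-- **LOSS–ERROR CEILING, every decoder.** For one error type (checks `H`, trivial subspace `S`), ANY erasure-aware
decoder `D`, loss rate `0 ≤ y ≤ 1` and flip rate `0 ≤ p ≤ 1/2`:
`P_{y + 2p(1−y)}[erasure uncorrectable] ≤ 2 · P^mixed_{y,p}[D fails]` — flips at rate `p` on the kept qubits are
erasures at rate `2p` filled with fair coins; the union of the two erasure patterns has rate `y + 2p(1−y)`, and on an
uncorrectable union the coins defeat `D` at least half the time. (`y = 0`: `uncorrectableProb_two_mul_le`.)
[cite: RichardsonUrbanke2008, Lemma 4.78 (Erasure Decomposition Lemma); DumerKovalevPryadko2015, eq. (min-E-condition) (mixed channel); StaceBarrettDoherty2009, p. 2] -/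
theorem uncorrectableProb_le_two_mul_mixedFailureProb (H : Matrix ι V (ZMod 2))
    (S : Submodule (ZMod 2) (V → ZMod 2)) (D : ErasureDecoder V (ι → ZMod 2)) {y p : ℝ} (hy0 : 0 ≤ y)
    (hy1 : y ≤ 1) (hp0 : 0 ≤ p) (hp : p ≤ 1 / 2) :
    ErasureDecoder.uncorrectableProb {x | H *ᵥ x = 0} (S : Set (V → ZMod 2)) (y + (1 - y) * (2 * p)) ≤
      2 * mixedFailureProb H (S : Set (V → ZMod 2)) D y p := by
  have hw0 : ∀ Er : Finset V, 0 ≤ p ^ Er.card * (1 - 2 * p) ^ (Fintype.card V - Er.card) :=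
    fun Er => mul_nonneg (pow_nonneg hp0 _) (pow_nonneg (by linarith) _)
  -- Step 1: for each loss pattern `Er`, decompose the flips into erasures `Er₂` of rate `2p` and coins
  have hinner : ∀ Er : Finset V,
      ∑ E ∈ univ.filter (fun E : Finset V => ∃ e : V → ZMod 2, supp e \ Er = E \ Er ∧
          ¬ D.Corrects (fun e => H *ᵥ e) (S : Set (V → ZMod 2)) Er e), bernoulliWeight p E =
        ∑ Er₂ : Finset V, p ^ Er₂.card * (1 - 2 * p) ^ (Fintype.card V - Er₂.card) *
          (((Er₂.powerset).filter fun E : Finset V => ∃ e : V → ZMod 2, supp e \ Er = E \ Er ∧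
            ¬ D.Corrects (fun e => H *ᵥ e) (S : Set (V → ZMod 2)) Er e).card : ℝ) := by
    intro Er
    calc ∑ E ∈ univ.filter (fun E : Finset V => ∃ e : V → ZMod 2, supp e \ Er = E \ Er ∧
            ¬ D.Corrects (fun e => H *ᵥ e) (S : Set (V → ZMod 2)) Er e), bernoulliWeight p E
        = ∑ E ∈ univ.filter (fun E : Finset V => ∃ e : V → ZMod 2, supp e \ Er = E \ Er ∧
            ¬ D.Corrects (fun e => H *ᵥ e) (S : Set (V → ZMod 2)) Er e),
            ∑ Er₂ ∈ univ.filter (fun Er₂ : Finset V => E ⊆ Er₂),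
              p ^ Er₂.card * (1 - 2 * p) ^ (Fintype.card V - Er₂.card) :=
          Finset.sum_congr rfl fun E _ => bernoulliWeight_eq_sum_superset p E
      _ = ∑ E ∈ univ.filter (fun E : Finset V => ∃ e : V → ZMod 2, supp e \ Er = E \ Er ∧
            ¬ D.Corrects (fun e => H *ᵥ e) (S : Set (V → ZMod 2)) Er e),
            ∑ Er₂ : Finset V, if E ⊆ Er₂ then
              p ^ Er₂.card * (1 - 2 * p) ^ (Fintype.card V - Er₂.card) else 0 :=
          Finset.sum_congr rfl fun E _ => by rw [Finset.sum_filter]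
      _ = ∑ Er₂ : Finset V, ∑ E ∈ univ.filter (fun E : Finset V => ∃ e : V → ZMod 2, supp e \ Er = E \ Er ∧
            ¬ D.Corrects (fun e => H *ᵥ e) (S : Set (V → ZMod 2)) Er e),
            if E ⊆ Er₂ then p ^ Er₂.card * (1 - 2 * p) ^ (Fintype.card V - Er₂.card) else 0 :=
          Finset.sum_comm
      _ = _ := by
          refine Finset.sum_congr rfl fun Er₂ _ => ?_
          have hset : (univ.filter (fun E : Finset V => ∃ e : V → ZMod 2, supp e \ Er = E \ Er ∧
                ¬ D.Corrects (fun e => H *ᵥ e) (S : Set (V → ZMod 2)) Er e)).filter (fun E => E ⊆ Er₂) =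
              (Er₂.powerset).filter fun E : Finset V => ∃ e : V → ZMod 2, supp e \ Er = E \ Er ∧
                ¬ D.Corrects (fun e => H *ᵥ e) (S : Set (V → ZMod 2)) Er e := by
            ext E
            simp only [Finset.mem_filter, Finset.mem_univ, true_and, Finset.mem_powerset]
            tauto
          rw [← Finset.sum_filter, Finset.sum_const, nsmul_eq_mul, hset, mul_comm]
  -- Step 2: on an uncorrectable union at least half of the coin patterns fail
  have hstep2 : ∀ Er : Finset V,
      ∑ Er₂ : Finset V, bernoulliWeight (2 * p) Er₂ *
          (if ¬ IsCorrectableErasure {x | H *ᵥ x = 0} (S : Set (V → ZMod 2)) (Er ∪ Er₂) then (1 : ℝ) else 0) ≤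
        2 * ∑ E ∈ univ.filter (fun E : Finset V => ∃ e : V → ZMod 2, supp e \ Er = E \ Er ∧
          ¬ D.Corrects (fun e => H *ᵥ e) (S : Set (V → ZMod 2)) Er e), bernoulliWeight p E := by
    intro Er
    rw [hinner Er, Finset.mul_sum]
    refine Finset.sum_le_sum fun Er₂ _ => ?_
    by_cases hc : IsCorrectableErasure {x | H *ᵥ x = 0} (S : Set (V → ZMod 2)) (Er ∪ Er₂)
    · simp only [not_true_eq_false, hc, if_false, mul_zero]
      exact mul_nonneg (by norm_num) (mul_nonneg (hw0 Er₂) (Nat.cast_nonneg _))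
    · simp only [hc, not_false_eq_true, if_true, mul_one]
      have hcount := two_pow_le_two_mul_card_mixed_fail H S D hc
      have hcount' : ((2 : ℝ) ^ Er₂.card) ≤
          2 * (((Er₂.powerset).filter fun E : Finset V => ∃ e : V → ZMod 2, supp e \ Er = E \ Er ∧
            ¬ D.Corrects (fun e => H *ᵥ e) (S : Set (V → ZMod 2)) Er e).card : ℝ) := by
        exact_mod_cast hcount
      have hbw : bernoulliWeight (2 * p) Er₂ =
          (2 : ℝ) ^ Er₂.card * (p ^ Er₂.card * (1 - 2 * p) ^ (Fintype.card V - Er₂.card)) := by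
        rw [bernoulliWeight, mul_pow]
        ring
      rw [hbw]
      calc (2 : ℝ) ^ Er₂.card * (p ^ Er₂.card * (1 - 2 * p) ^ (Fintype.card V - Er₂.card))
          ≤ (2 * (((Er₂.powerset).filter fun E : Finset V => ∃ e : V → ZMod 2, supp e \ Er = E \ Er ∧
              ¬ D.Corrects (fun e => H *ᵥ e) (S : Set (V → ZMod 2)) Er e).card : ℝ)) *
              (p ^ Er₂.card * (1 - 2 * p) ^ (Fintype.card V - Er₂.card)) :=
            mul_le_mul_of_nonneg_right hcount' (hw0 Er₂)
        _ = _ := by ring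
  -- Step 3: average over the loss pattern and recognise the union law
  have hlhs : ErasureDecoder.uncorrectableProb {x | H *ᵥ x = 0} (S : Set (V → ZMod 2)) (y + (1 - y) * (2 * p)) =
      ∑ Er : Finset V, bernoulliWeight y Er * ∑ Er₂ : Finset V, bernoulliWeight (2 * p) Er₂ *
        (if ¬ IsCorrectableErasure {x | H *ᵥ x = 0} (S : Set (V → ZMod 2)) (Er ∪ Er₂) then (1 : ℝ) else 0) := by
    rw [sum_bernoulliWeight_mul_sum_union y (2 * p)
      (fun C => if ¬ IsCorrectableErasure {x | H *ᵥ x = 0} (S : Set (V → ZMod 2)) C then (1 : ℝ) else 0),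
      ErasureDecoder.uncorrectableProb_eq_sum, Finset.sum_filter]
    refine Finset.sum_congr rfl fun C _ => ?_
    split_ifs <;> simp
  rw [hlhs, mixedFailureProb, Finset.mul_sum]
  refine Finset.sum_le_sum fun Er _ => ?_
  have h := mul_le_mul_of_nonneg_left (hstep2 Er) (bernoulliWeight_nonneg hy0 hy1 Er)
  linarith

end Mixed

/-! ### CSS codes and families: the ceiling curve `p ≤ (1 − 2y)/(4(1 − y))` -/

section CSS

variable {RX RZ V : Type*} [Fintype V] [DecidableEq V] [Fintype RX] [Fintype RZ]

open Classical in
/-- **Erasure-symmetric CSS codes on the curve `y + 2p(1−y) = 1/2`**: for a CSS code with `k ≥ 1` whose two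
sectors have the same erasure behaviour, every erasure-aware decoder of the `Z`-sector fails with probability
`≥ 1/4` at loss rate `0 ≤ y ≤ 1` and flip rate `0 ≤ p ≤ 1/2` with `y + 2p(1−y) = 1/2`.
[cite: StaceBarrettDoherty2009, p. 2 and Fig. 2; RichardsonUrbanke2008, Lemma 4.78] -/
theorem CSSCode.quarter_le_mixedFailureProb_of_symm (C : CSSCode RX RZ V) (hk : 0 < C.k)
    (hsymm : ∀ y, ErasureDecoder.uncorrectableProb {x | C.HZ *ᵥ x = 0} (C.rowSpX : Set (V → ZMod 2)) y =
      ErasureDecoder.uncorrectableProb {x | C.HX *ᵥ x = 0} (C.rowSpZ : Set (V → ZMod 2)) y)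
    (D : ErasureDecoder V (RX → ZMod 2)) {y p : ℝ} (hy0 : 0 ≤ y) (hy1 : y ≤ 1) (hp0 : 0 ≤ p) (hp : p ≤ 1 / 2)
    (hcurve : y + (1 - y) * (2 * p) = 1 / 2) :
    1 / 4 ≤ mixedFailureProb C.HX (C.rowSpZ : Set (V → ZMod 2)) D y p := by
  have h := uncorrectableProb_le_two_mul_mixedFailureProb C.HX C.rowSpZ D hy0 hy1 hp0 hp
  rw [hcurve] at h
  have h1 := C.one_le_uncorrectableProb_add hk (y := 1 / 2) (by norm_num) (by norm_num)
  rw [show (1 : ℝ) - 1 / 2 = 1 / 2 by norm_num, hsymm] at h1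
  linarith

open Classical in
/-- **Complementary point for two sectors**: for any CSS code with `k ≥ 1`, ANY erasure-aware `Z`-decoder `D_Z`
at `(y, p)` and the `X`-sector erasure at the complementary rate: `1 ≤ 2 P^{mixed,Z}_{y,p}[D_Z] + P^X_{1 − y − 2p(1−y)}`.
[cite: StaceBarrettDoherty2009, p. 2; RichardsonUrbanke2008, Lemma 4.78] -/
theorem CSSCode.one_le_two_mul_mixed_add_uncorrectable (C : CSSCode RX RZ V) (hk : 0 < C.k)
    (D : ErasureDecoder V (RX → ZMod 2)) {y p : ℝ} (hy0 : 0 ≤ y) (hy1 : y ≤ 1) (hp0 : 0 ≤ p) (hp : p ≤ 1 / 2) :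
    1 ≤ 2 * mixedFailureProb C.HX (C.rowSpZ : Set (V → ZMod 2)) D y p +
      ErasureDecoder.uncorrectableProb {x | C.HZ *ᵥ x = 0} (C.rowSpX : Set (V → ZMod 2))
        (1 - (y + (1 - y) * (2 * p))) := by
  have h := uncorrectableProb_le_two_mul_mixedFailureProb C.HX C.rowSpZ D hy0 hy1 hp0 hp
  have hr0 : 0 ≤ y + (1 - y) * (2 * p) := by nlinarith
  have hr1 : y + (1 - y) * (2 * p) ≤ 1 := by nlinarith
  have h1 := C.one_le_uncorrectableProb_add hk hr0 hr1
  linarith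

end CSS

section Thresholds

variable {RX RZ Q : ℕ → Type*} [∀ i, Fintype (Q i)] [∀ i, DecidableEq (Q i)] [∀ i, Fintype (RX i)]
  [∀ i, Fintype (RZ i)]

open Classical in
/-- **THE CEILING CURVE OF THE LOSS–ERROR PHASE DIAGRAM, every decoder.** For a family of CSS codes with `k ≥ 1`
whose two sectors have the same erasure behaviour (toric, planar, abelian two-block families), at loss rate
`0 ≤ y < 1/2` every certified flip-threshold lower bound `a` of the mixed-channel failure family (ANY erasure-aware
decoder family) satisfies `a ≤ (1 − 2y)/(4(1 − y))` — the point of the curve `y + 2p(1−y) = 1/2`, where every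
decoder fails with probability `≥ 1/4`. (`y = 0`: `a ≤ 1/4`.) [cite: StaceBarrettDoherty2009, p. 2 and Fig. 2 (boundary of the correctable region); RichardsonUrbanke2008, Lemma 4.78] -/
theorem mixed_threshold_le_of_symm (C : ∀ i, CSSCode (RX i) (RZ i) (Q i)) (hk : ∀ i, 0 < (C i).k)
    (hsymm : ∀ i y, ErasureDecoder.uncorrectableProb {x : Q i → ZMod 2 | (C i).HZ *ᵥ x = 0}
        ((C i).rowSpX : Set (Q i → ZMod 2)) y =
      ErasureDecoder.uncorrectableProb {x : Q i → ZMod 2 | (C i).HX *ᵥ x = 0}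
        ((C i).rowSpZ : Set (Q i → ZMod 2)) y)
    (D : ∀ i, ErasureDecoder (Q i) (RX i → ZMod 2)) {y : ℝ} (hy0 : 0 ≤ y) (hy : y < 1 / 2) {a : ℝ}
    (ha : IsThresholdLowerBound
      (fun i p => mixedFailureProb (C i).HX ((C i).rowSpZ : Set (Q i → ZMod 2)) (D i) y p) a) :
    a ≤ (1 - 2 * y) / (4 * (1 - y)) := by
  by_contra h
  push Not at h
  have hy1 : 0 < 1 - y := by linarith
  have hp0 : 0 ≤ (1 - 2 * y) / (4 * (1 - y)) := div_nonneg (by linarith) (by linarith)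
  have hp : (1 - 2 * y) / (4 * (1 - y)) ≤ 1 / 2 := by
    rw [div_le_iff₀ (by linarith)]
    linarith
  have hcurve : y + (1 - y) * (2 * ((1 - 2 * y) / (4 * (1 - y)))) = 1 / 2 := by
    field_simp
    ring
  refine not_belowThreshold_of_le (c := 1 / 4) (by norm_num) (fun i => ?_) (ha _ hp0 h)
  exact (C i).quarter_le_mixedFailureProb_of_symm (hk i) (hsymm i) (D i) hy0 (by linarith) hp0 hp hcurve

open Classical in
/-- Accuracy-threshold form of the ceiling curve: `p_c^{mixed}(y) ≤ (1 − 2y)/(4(1 − y))` for `0 ≤ y < 1/2`, every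
erasure-aware decoder family, erasure-symmetric families with `k ≥ 1`.
[cite: StaceBarrettDoherty2009, p. 2 and Fig. 2; DennisEtAl2002, §4.6 (p_c)] -/
theorem mixed_accuracyThreshold_le_of_symm (C : ∀ i, CSSCode (RX i) (RZ i) (Q i)) (hk : ∀ i, 0 < (C i).k)
    (hsymm : ∀ i y, ErasureDecoder.uncorrectableProb {x : Q i → ZMod 2 | (C i).HZ *ᵥ x = 0}
        ((C i).rowSpX : Set (Q i → ZMod 2)) y =
      ErasureDecoder.uncorrectableProb {x : Q i → ZMod 2 | (C i).HX *ᵥ x = 0}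
        ((C i).rowSpZ : Set (Q i → ZMod 2)) y)
    (D : ∀ i, ErasureDecoder (Q i) (RX i → ZMod 2)) {y : ℝ} (hy0 : 0 ≤ y) (hy : y < 1 / 2) :
    accuracyThreshold (fun i p => mixedFailureProb (C i).HX ((C i).rowSpZ : Set (Q i → ZMod 2)) (D i) y p) ≤
      (1 - 2 * y) / (4 * (1 - y)) :=
  mixed_threshold_le_of_symm C hk hsymm D hy0 hy (isThresholdLowerBound_accuracyThreshold _)

end Thresholds

end Literature.InformationTheory.QuantumCodes
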